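import Mathlib
import HarnessLib
import Literature.Analysis.FluidPDE.MildSolution
import Literature.Analysis.FluidPDE.NSBoundedMildOseenDuhamel
import Literature.Analysis.UnboundedOperators.HeatKernelBoundedData
import Literature.Analysis.UnboundedOperators.HeatExtensionDecay

/-!
# Route `ExtremiserTransience`, LINE g5-α repair (seat ns-idea-5 g5): fields of the weak one-slice class are weakly DIVERGENCE FREE

`--supports stmt-NavierStokesRegularity-27823` (`PlateauSliceRigidity`).  The class of items 27822/27823 — `W` continuous on `(−∞,0)×ℝ³`, Oseen-mild
with `ν = 1` from EVERY `s < t < 0` (`W t = e^{(t−s)Δ} W s − B_s(W,W)(t)`), Type-I decay `√(−t)‖W t x‖ ≤ K` — has no divergence-free clause.  This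
file proves that it FOLLOWS from the class (critic idea-crit-4 12:38Z: «state this as the first lemma» of the local energy budget, where the Riesz
pressure with the ball mean removed needs `∫ W·∇φ = 0`): letting `s → −∞` in the mild identity, the caloric term is bounded by `K/√(−s) → 0`
(`norm_heatExtension_le_of_bound`), so `W t` is the pointwise bounded limit of the fields `−B_s(W,W)(t)`, each weakly divergence free by the tree's
`isWeaklyDivFree_oseenDuhamel` (Koch–Tataru: the kernel of `e^{σΔ}P∇·` is divergence free), and weak incompressibility passes to pointwise bounded limits
(dominated convergence against `∇θ`; the tree's lemma of that name in `BoundedWeakDriftLimit.lean` is private, so it is re-proved here).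
HONEST FRAMING: a lemma about a hypothetical class of ancient fields; nothing about Navier–Stokes regularity is proved and no summit is proved by a line.
[folklore]
-/

namespace Summit.NavierStokesRegularity.NavierStokesRegularity.Theorems.ExtremiserTransience
set_option linter.dupNamespace false

open Set Function MeasureTheory Filter Topology
open scoped RealInnerProductSpace
open Literature.Analysis Literature.Analysis.FluidPDE Literature.Analysis.UnboundedOperators

/-- **Pointwise bounded limits of weakly divergence-free fields are weakly divergence free** (dominated convergence against `∇θ`; the tree's
`BoundedWeakDriftLimit` version is private). [folklore] -/
theorem isWeaklyDivFree_of_tendsto_of_bound {V : ℕ → EuclideanSpace ℝ (Fin 3) → EuclideanSpace ℝ (Fin 3)}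
    {v : EuclideanSpace ℝ (Fin 3) → EuclideanSpace ℝ (Fin 3)} {M : ℝ}
    (hdiv : ∀ᶠ k in atTop, IsWeaklyDivFree (V k))
    (hmeas : ∀ᶠ k in atTop, AEStronglyMeasurable (V k) volume)
    (hbd : ∀ᶠ k in atTop, ∀ x, ‖V k x‖ ≤ M)
    (hlim : ∀ x, Tendsto (fun k => V k x) atTop (𝓝 (v x))) : IsWeaklyDivFree v := by
  intro θ hθ
  have hθ1 : ContDiff ℝ 1 θ := contDiff_infty.1 hθ.contDiff 1
  have hgc : HasCompactSupport (gradient θ) := by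
    have : gradient θ = (fun L => (InnerProductSpace.toDual ℝ (EuclideanSpace ℝ (Fin 3))).symm L) ∘ fderiv ℝ θ := rfl
    rw [this]
    exact (hθ.hasCompactSupport.fderiv (𝕜 := ℝ)).comp_left (by simp)
  have hθi : Integrable (fun x => M * ‖gradient θ x‖) volume :=
    (((continuous_gradient_of_contDiff hθ1).integrable_of_hasCompactSupport hgc).norm).const_mul M
  have hlimθ : Tendsto (fun k => ∫ x, ⟪V k x, gradient θ x⟫) atTop (𝓝 (∫ x, ⟪v x, gradient θ x⟫)) := by
    refine tendsto_integral_filter_of_dominated_convergence (fun x => M * ‖gradient θ x‖)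
      ?_ ?_ hθi (Eventually.of_forall fun x => (hlim x).inner tendsto_const_nhds)
    · filter_upwards [hmeas] with k hk
      exact hk.inner (continuous_gradient_of_contDiff hθ1).aestronglyMeasurable
    · filter_upwards [hbd] with k hk
      exact Eventually.of_forall fun x => (norm_inner_le_norm _ _).trans
        (mul_le_mul_of_nonneg_right (hk x) (norm_nonneg _))
  have hzero : ∀ᶠ k in atTop, ∫ x, ⟪V k x, gradient θ x⟫ = 0 := by
    filter_upwards [hdiv] with k hk
    exact hk θ hθ
  exact tendsto_nhds_unique hlimθ (tendsto_const_nhds.congr' (hzero.mono fun k hk => hk.symm))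

/-- The negative of a weakly divergence-free field is weakly divergence free. [folklore] -/
theorem isWeaklyDivFree_neg {D : EuclideanSpace ℝ (Fin 3) → EuclideanSpace ℝ (Fin 3)} (h : IsWeaklyDivFree D) :
    IsWeaklyDivFree (fun x => -D x) := by
  intro θ hθ
  have h0 := h θ hθ
  simp only [inner_neg_left, integral_neg, h0, neg_zero]

/-- **Weak-class fields are weakly divergence free at every negative time.**  Hypotheses = the class clauses of items 27822/27823 verbatim
(continuity on `(−∞,0)×ℝ³`, Oseen-mildness from every `s < t < 0` with `ν = 1`, Type-I decay `√(−t)‖W‖ ≤ K`). [folklore] -/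
theorem weakClass_isWeaklyDivFree (W : ℝ → EuclideanSpace ℝ (Fin 3) → EuclideanSpace ℝ (Fin 3)) (K : ℝ)
    (hcont : ContinuousOn (Function.uncurry W) (Set.Iio (0 : ℝ) ×ˢ Set.univ))
    (hmild : ∀ s t : ℝ, s < t → t < 0 → ∀ x, W t x =
      Literature.Analysis.FluidPDE.heatFlow (W s) (t - s) x - Literature.Analysis.FluidPDE.oseenDuhamel 1 s W W t x)
    (hdec : ∀ t : ℝ, t < 0 → ∀ x, Real.sqrt (-t) * ‖W t x‖ ≤ K) :
    ∀ t < 0, IsWeaklyDivFree (W t) := by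
  intro t ht
  have hst : 0 < Real.sqrt (-t) := Real.sqrt_pos.2 (by linarith)
  have hK : 0 ≤ K := le_trans (mul_nonneg hst.le (norm_nonneg (W t 0))) (hdec t ht 0)
  -- slices are continuous and bounded by `K/√(−τ)`
  have hslice : ∀ τ < 0, Continuous (W τ) := fun τ hτ =>
    hcont.comp_continuous (Continuous.prodMk_right τ) fun x => ⟨hτ, mem_univ x⟩
  have hbd : ∀ τ < 0, ∀ y, ‖W τ y‖ ≤ K / Real.sqrt (-τ) := by
    intro τ hτ y
    rw [le_div_iff₀ (Real.sqrt_pos.2 (by linarith)), mul_comm]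
    exact hdec τ hτ y
  -- backward times `s_k = t − (k + 1) → −∞`
  set s : ℕ → ℝ := fun k => t - ((k : ℝ) + 1) with hs
  have hs_lt : ∀ k, s k < t := by
    intro k
    have : (0 : ℝ) < (k : ℝ) + 1 := by positivity
    simp only [hs]; linarith
  have hs_neg : ∀ k, s k < 0 := fun k => (hs_lt k).trans ht
  have hs_negval : ∀ k, -(s k) = (k : ℝ) + (1 - t) := by intro k; simp only [hs]; ring
  -- earlier slices are bounded by `K/√(−t)` on `(s_k, t)`
  have hbd_t : ∀ k, ∀ τ ∈ Ioo (s k) t, ∀ y, ‖W τ y‖ ≤ K / Real.sqrt (-t) := by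
    intro k τ hτ y
    have hτ0 : τ < 0 := hτ.2.trans ht
    refine (hbd τ hτ0 y).trans ?_
    exact div_le_div_of_nonneg_left hK hst (Real.sqrt_le_sqrt (by linarith [hτ.2]))
  -- the caloric term `H_k = e^{(t−s_k)Δ} W(s_k)` is continuous and bounded by `K/√(−s_k) ≤ K/√(−t)`
  have hHcont : ∀ k, Continuous (heatFlow (W (s k)) (t - s k)) := by
    intro k
    rw [heatFlow_of_pos (W (s k)) (sub_pos.2 (hs_lt k))]
    exact (contDiff_heatExtension_of_bound (m := 0) (hslice (s k) (hs_neg k)) (hbd (s k) (hs_neg k))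
      (sub_pos.2 (hs_lt k))).continuous
  have hHbd : ∀ k x, ‖heatFlow (W (s k)) (t - s k) x‖ ≤ K / Real.sqrt (-(s k)) := by
    intro k x
    rw [heatFlow_of_pos (W (s k)) (sub_pos.2 (hs_lt k))]
    exact norm_heatExtension_le_of_bound (hbd (s k) (hs_neg k)) (sub_pos.2 (hs_lt k)) x
  have hHbd' : ∀ k x, ‖heatFlow (W (s k)) (t - s k) x‖ ≤ K / Real.sqrt (-t) := by
    intro k x
    refine (hHbd k x).trans (div_le_div_of_nonneg_left hK hst (Real.sqrt_le_sqrt ?_))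
    linarith [hs_lt k]
  -- the approximants `V_k = −B_{s_k}(W,W)(t) = W t − H_k`
  have hV : ∀ k x, -(oseenDuhamel 1 (s k) W W t x) = W t x - heatFlow (W (s k)) (t - s k) x := by
    intro k x
    rw [hmild (s k) t (hs_lt k) ht x]
    abel
  refine isWeaklyDivFree_of_tendsto_of_bound (V := fun k x => -(oseenDuhamel 1 (s k) W W t x))
    (M := K / Real.sqrt (-t) + K / Real.sqrt (-t)) ?_ ?_ ?_ ?_
  · -- each `V_k` is weakly divergence free (Koch–Tataru kernel identity, tree)
    refine Eventually.of_forall fun k => isWeaklyDivFree_neg ?_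
    have hmeasW : AEStronglyMeasurable (uncurry W)
        ((volume : Measure (ℝ × EuclideanSpace ℝ (Fin 3))).restrict (Ioo (s k) t ×ˢ univ)) := by
      have hsub : Ioo (s k) t ×ˢ (univ : Set (EuclideanSpace ℝ (Fin 3))) ⊆ Iio 0 ×ˢ univ :=
        prod_mono (fun τ hτ => hτ.2.trans ht) le_rfl
      exact (hcont.mono hsub).aestronglyMeasurable (measurableSet_Ioo.prod MeasurableSet.univ)
    exact isWeaklyDivFree_oseenDuhamel one_pos hmeasW hmeasW (div_nonneg hK hst.le) (hbd_t k) (hbd_t k)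
      (hs_lt k) le_rfl
  · -- measurability: `V_k = W t − H_k` is continuous
    refine Eventually.of_forall fun k => ?_
    have : (fun x => -(oseenDuhamel 1 (s k) W W t x)) = fun x => W t x - heatFlow (W (s k)) (t - s k) x :=
      funext (hV k)
    rw [this]
    exact ((hslice t ht).sub (hHcont k)).aestronglyMeasurable
  · -- uniform bound
    refine Eventually.of_forall fun k x => ?_
    show ‖-(oseenDuhamel 1 (s k) W W t x)‖ ≤ _
    rw [hV k x]
    exact (norm_sub_le _ _).trans (add_le_add (hbd t ht x) (hHbd' k x))
  · -- pointwise convergence: `‖V_k x − W t x‖ = ‖H_k x‖ ≤ K/√(k + 1 − t) → 0`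
    intro x
    have hlim0 : Tendsto (fun k : ℕ => K / Real.sqrt (-(s k))) atTop (𝓝 0) := by
      have h1 : Tendsto (fun k : ℕ => (k : ℝ) + (1 - t)) atTop atTop :=
        tendsto_atTop_add_const_right atTop (1 - t) tendsto_natCast_atTop_atTop
      have h2 : Tendsto (fun k : ℕ => Real.sqrt (-(s k))) atTop atTop := by
        simp_rw [hs_negval]
        exact Real.tendsto_sqrt_atTop.comp h1
      exact tendsto_const_nhds.div_atTop h2
    rw [tendsto_iff_norm_sub_tendsto_zero]
    refine squeeze_zero (fun k => norm_nonneg _) (fun k => ?_) hlim0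
    show ‖-(oseenDuhamel 1 (s k) W W t x) - W t x‖ ≤ K / Real.sqrt (-(s k))
    rw [hV k x, sub_sub_cancel_left, norm_neg]
    exact hHbd k x

end Summit.NavierStokesRegularity.NavierStokesRegularity.Theorems.ExtremiserTransience
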